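import Summits.QuantumFields.GaugeBoot.TiltedRPPlaquettes
import HarnessLib

/-!
# Tilted diagonal frames: holonomies under the swap and the cut-plaquette identity (gauge-boot, L3(σ) part 4)

HONEST FRAMING (cell `pub-gaugeboot`, page 1 of every file): the venture produces certified bounds
on lattice expectations at stated coupling, gauge group, dimension and torus size; NOT a mass gap,
NOT a continuum limit, NOT a string tension; NOT Yang–Mills-summit-bearing (barriers
`FixedCouplingUltralocality`, `PerturbativeInvisibility`).

Continuation of `TiltedRPPlaquettes.lean` (tilted diagonal frame `IsTiltedFrame e i j θ P v` on a
periodic lattice; `Θ = configSwap i j θ`; plaquette classes Pos/Neg/Cut/Mirror). Here the link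
variables enter:

* `holonomy_configSwap` — `(ΘU)_{x;k,l} = U_{θx;(i j)k,(i j)l}`, hence
  `Re tr ρ((ΘU)_p) = Re tr ρ(U_{plaqSwap p})` (`plaqObs_configSwap`; an orientation reversal is
  absorbed by `Re tr ρ(g⁻¹) = Re tr ρ(g)` for a continuous representation of a compact group);
* `sum_plaqObs_split` — `∑_p Re tr ρ(U_p) = A(U) + A(ΘU) + M(U) + C(U)` with `A` the sum over the
  positive plaquettes, `M` over the mirror plaquettes (`Θ`-invariant), `C` over the cut plaquettes;
* `halfPlaq` — the holonomy of the INNER half of a cut plaquette: at the bottom layer `v = 0` the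
  path `x → x + e_i → x + e_i + e_j` (through height `1`), at the top layer `v = P` the path
  `x → x + e_j → x + e_j + e_i` (through height `P - 1`); its two links are links of the closed half
  and its mirror image is the other half (`halfPlaq_configSwap`);
* `plaqObs_eq_sum_halfPlaq` — **the cut-plaquette identity** (Osterwalder–Seiler 1978 §2):
  `Re tr ρ(U_p) = ∑_{a,b} Re (σ(A_p(U))_{ab} conj σ(A_p(ΘU))_{ab})`, `σ` the unitarised
  representation (`Literature.RepresentationTheory.CompactGroups.UnitaryTrick`);
* `coeff` / `sum_coeff_mul_conj` — the Gram coefficients `a_ι` with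
  `∑_ι a_ι(U) conj a_ι(ΘU) = β C(U)` (`β ≥ 0`), bounded by `√(β/2)`, measurable, depending only on
  the links of the closed half.

References: K. Osterwalder, E. Seiler, Ann. Phys. 110 (1978) 440, §2; E. Seiler, LNP 159 (1982)
Ch. 2; J. Fröhlich, R. Israel, E. H. Lieb, B. Simon, J. Stat. Phys. 22 (1980) 297, §3.
-/

noncomputable section

open Literature.RepresentationTheory.CompactGroups

namespace Summit.QuantumFields.GaugeBoot

namespace TiltedRP

namespace IsTiltedFrame

variable {A : Type*} [AddCommGroup A] {d : ℕ}
variable {e : Fin d → A} {i j : Fin d} {θ : A →+ A} {P : ℕ} {v : A →+ ZMod (2 * P)}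
variable (hF : IsTiltedFrame e i j θ P v)
include hF

/-! ## Holonomies under the swap -/

section Holonomy

variable {G : Type*} [Group G]

/-- **`(ΘU)` has at `(x; k, l)` the holonomy of `U` at `(θx; (i j) k, (i j) l)`.** -/
theorem holonomy_configSwap (U : Config A d G) (x : A) (k l : Fin d) :
    holonomy e (configSwap i j θ U) x k l =
      holonomy e U (θ x) (Equiv.swap i j k) (Equiv.swap i j l) := by
  simp only [holonomy, configSwap_apply, linkSwap_mk, hF.map_add_e]

/-- The holonomy of `ΘU` around `p` is the holonomy of `U` around `plaqSwap p`, or its inverse. -/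
theorem holonomy_configSwap_eq_or (U : Config A d G) (p : Plaq A d) :
    holonomy e (configSwap i j θ U) p.1 p.2.1.1 p.2.1.2 = holonomy e U (plaqSwap i j θ p).1
        (plaqSwap i j θ p).2.1.1 (plaqSwap i j θ p).2.1.2 ∨
      holonomy e (configSwap i j θ U) p.1 p.2.1.1 p.2.1.2 = (holonomy e U (plaqSwap i j θ p).1
        (plaqSwap i j θ p).2.1.1 (plaqSwap i j θ p).2.1.2)⁻¹ := by
  obtain ⟨x, ⟨⟨k, l⟩, hkl⟩⟩ := p
  have hkl' : k < l := hkl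
  rw [hF.holonomy_configSwap]
  by_cases h : Equiv.swap i j k < Equiv.swap i j l
  · rw [plaqSwap_of_lt i j θ x hkl' h]
    exact Or.inl rfl
  · rw [plaqSwap_of_not_lt i j θ x hkl' h]
    exact Or.inr (by rw [← holonomy_swap_dirs])

end Holonomy

/-! ## Plaquette observables under the swap; splitting the action -/

section Obs

variable {N : ℕ} {G : Type*} [Group G] [TopologicalSpace G] [IsTopologicalGroup G] [CompactSpace G]
variable (ρ : G →* Matrix (Fin N) (Fin N) ℂ)

omit [TopologicalSpace G] [IsTopologicalGroup G] [CompactSpace G] hF in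
/-- Plaquette observables are determined by the four links of the plaquette. -/
theorem plaqObs_congr (p : Plaq A d) {U V : Config A d G} (h1 : U (p.1, p.2.1.1) = V (p.1, p.2.1.1))
    (h2 : U (p.1 + e p.2.1.1, p.2.1.2) = V (p.1 + e p.2.1.1, p.2.1.2))
    (h3 : U (p.1 + e p.2.1.2, p.2.1.1) = V (p.1 + e p.2.1.2, p.2.1.1))
    (h4 : U (p.1, p.2.1.2) = V (p.1, p.2.1.2)) : plaqObs ρ e p U = plaqObs ρ e p V := by
  simp only [plaqObs, holonomy, h1, h2, h3, h4]

/-- **`Re tr ρ((ΘU)_p) = Re tr ρ(U_{plaqSwap p})`.** -/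
theorem plaqObs_configSwap (hρ : Continuous ρ) (p : Plaq A d) (U : Config A d G) :
    plaqObs ρ e p (configSwap i j θ U) = plaqObs ρ e (plaqSwap i j θ p) U := by
  unfold plaqObs
  rcases hF.holonomy_configSwap_eq_or U p with h | h
  · rw [h]
  · rw [h, CompactGroup.re_trace_map_inv ρ hρ]

/-- `Re tr ρ((ΘU)_{plaqSwap p}) = Re tr ρ(U_p)`. -/
theorem plaqObs_plaqSwap_configSwap (hρ : Continuous ρ) (p : Plaq A d) (U : Config A d G) :
    plaqObs ρ e (plaqSwap i j θ p) (configSwap i j θ U) = plaqObs ρ e p U := by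
  rw [hF.plaqObs_configSwap ρ hρ, hF.plaqSwap_plaqSwap]

/-- A mirror plaquette has the same observable in `U` and in `ΘU`. -/
theorem plaqObs_configSwap_of_isMirrorPlaq (hρ : Continuous ρ) {p : Plaq A d}
    (hp : IsMirrorPlaq i j P v p) (U : Config A d G) :
    plaqObs ρ e p (configSwap i j θ U) = plaqObs ρ e p U := by
  rw [hF.plaqObs_configSwap ρ hρ, hF.plaqSwap_of_isMirrorPlaq hp]

variable [Fintype A]

open scoped Classical in
/-- **The negative plaquettes contribute the positive ones of the reflected configuration**:
`∑_{Neg} Re tr ρ(U_p) = ∑_{Pos} Re tr ρ((ΘU)_p)`. -/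
theorem sum_neg_eq_sum_pos_configSwap (hρ : Continuous ρ) (U : Config A d G) :
    ∑ p ∈ Finset.univ.filter (IsNegPlaq i j P v), plaqObs ρ e p U =
      ∑ p ∈ Finset.univ.filter (IsPosPlaq i j P v), plaqObs ρ e p (configSwap i j θ U) := by
  refine Finset.sum_nbij' (plaqSwap i j θ) (plaqSwap i j θ) (fun p hp => ?_) (fun p hp => ?_)
    (fun p _ => hF.plaqSwap_plaqSwap p) (fun p _ => hF.plaqSwap_plaqSwap p) fun p _ => ?_
  · rw [Finset.mem_filter] at hp ⊢
    exact ⟨Finset.mem_univ _, (hF.isPosPlaq_plaqSwap_iff p).2 hp.2⟩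
  · rw [Finset.mem_filter] at hp ⊢
    exact ⟨Finset.mem_univ _, (hF.isNegPlaq_plaqSwap_iff p).2 hp.2⟩
  · rw [hF.plaqObs_plaqSwap_configSwap ρ hρ]

open scoped Classical in
/-- The mirror plaquettes contribute a `Θ`-invariant amount. -/
theorem sum_mirror_configSwap (hρ : Continuous ρ) (U : Config A d G) :
    ∑ p ∈ Finset.univ.filter (IsMirrorPlaq i j P v), plaqObs ρ e p (configSwap i j θ U) =
      ∑ p ∈ Finset.univ.filter (IsMirrorPlaq i j P v), plaqObs ρ e p U :=
  Finset.sum_congr rfl fun _ hp =>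
    hF.plaqObs_configSwap_of_isMirrorPlaq ρ hρ (Finset.mem_filter.1 hp).2 U

open scoped Classical in
/-- **Splitting of the plaquette sum along the two layers**:
`∑_p Re tr ρ(U_p) = A(U) + A(ΘU) + M(U) + C(U)`. -/
theorem sum_plaqObs_split (hρ : Continuous ρ) (U : Config A d G) :
    ∑ p, plaqObs ρ e p U =
      ∑ p ∈ Finset.univ.filter (IsPosPlaq i j P v), plaqObs ρ e p U +
      ∑ p ∈ Finset.univ.filter (IsPosPlaq i j P v), plaqObs ρ e p (configSwap i j θ U) +
      ∑ p ∈ Finset.univ.filter (IsMirrorPlaq i j P v), plaqObs ρ e p U +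
      ∑ p ∈ Finset.univ.filter (IsCutPlaq i j P v), plaqObs ρ e p U := by
  rw [← hF.sum_neg_eq_sum_pos_configSwap ρ hρ U]
  set Q : Finset (Plaq A d) := Finset.univ
  set f : Plaq A d → ℝ := fun p => plaqObs ρ e p U
  have h1 := Finset.sum_filter_add_sum_filter_not Q (IsPosPlaq i j P v) f
  have h2 := Finset.sum_filter_add_sum_filter_not (Q.filter fun p => ¬ IsPosPlaq i j P v p)
    (IsCutPlaq i j P v) f
  have h3 := Finset.sum_filter_add_sum_filter_not
    ((Q.filter fun p => ¬ IsPosPlaq i j P v p).filter fun p => ¬ IsCutPlaq i j P v p)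
    (IsMirrorPlaq i j P v) f
  have e2 : (Q.filter fun p => ¬ IsPosPlaq i j P v p).filter (IsCutPlaq i j P v) =
      Q.filter (IsCutPlaq i j P v) := by
    rw [Finset.filter_filter]
    exact Finset.filter_congr fun p _ =>
      ⟨fun h => h.2, fun h => ⟨fun h' => hF.not_isCutPlaq_of_isPosPlaq h' h, h⟩⟩
  have e3 : ((Q.filter fun p => ¬ IsPosPlaq i j P v p).filter fun p => ¬ IsCutPlaq i j P v p).filter
      (IsMirrorPlaq i j P v) = Q.filter (IsMirrorPlaq i j P v) := by
    rw [Finset.filter_filter, Finset.filter_filter]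
    exact Finset.filter_congr fun p _ => ⟨fun h => h.2.2, fun h =>
      ⟨fun h' => hF.not_isMirrorPlaq_of_isPosPlaq h' h, fun h' => h'.not_isMirrorPlaq h, h⟩⟩
  have e4 : ((Q.filter fun p => ¬ IsPosPlaq i j P v p).filter fun p => ¬ IsCutPlaq i j P v p).filter
      (fun p => ¬ IsMirrorPlaq i j P v p) = Q.filter (IsNegPlaq i j P v) := by
    rw [Finset.filter_filter, Finset.filter_filter]
    exact Finset.filter_congr fun p _ => by unfold IsNegPlaq; tauto
  rw [e2] at h2
  rw [e3, e4] at h3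
  linarith

end Obs

/-! ## The inner half of a cut plaquette and the cut-plaquette identity -/

section Cut

variable {G : Type*} [Group G]

omit hF in
/-- The holonomy of the INNER HALF of a cut plaquette with base point `x`: at the bottom layer
(`v x = 0`) the path `x → x + e_i → x + e_i + e_j` through height `1`, at the top layer (`v x = P`)
the path `x → x + e_j → x + e_j + e_i` through height `P - 1`. -/
def halfPlaq (e : Fin d → A) (i j : Fin d) (v : A →+ ZMod (2 * P)) (p : Plaq A d)
    (U : Config A d G) : G :=
  if v p.1 = 0 then U (p.1, i) * U (p.1 + e i, j) else U (p.1, j) * U (p.1 + e j, i)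

/-- **The inner half of `ΘU` at a cut plaquette is the OTHER half of `U`.** -/
theorem halfPlaq_configSwap {p : Plaq A d} (hp : IsCutPlaq i j P v p) (U : Config A d G) :
    halfPlaq e i j v p (configSwap i j θ U) =
      if v p.1 = 0 then U (p.1, j) * U (p.1 + e j, i) else U (p.1, i) * U (p.1 + e i, j) := by
  have hx : θ p.1 = p.1 := hF.map_of_isLayer hp.1
  simp only [halfPlaq, configSwap_apply, linkSwap_mk, hF.map_add_e, hx, Equiv.swap_apply_left,
    Equiv.swap_apply_right]

omit hF in
/-- The inner half is determined by its two links. -/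
theorem halfPlaq_congr (p : Plaq A d) {U V : Config A d G} (h1 : U (p.1, i) = V (p.1, i))
    (h2 : U (p.1 + e i, j) = V (p.1 + e i, j)) (h3 : U (p.1, j) = V (p.1, j))
    (h4 : U (p.1 + e j, i) = V (p.1 + e j, i)) : halfPlaq e i j v p U = halfPlaq e i j v p V := by
  simp only [halfPlaq, h1, h2, h3, h4]

/-- **The links of the inner half of a cut plaquette are links of the closed half** (bottom layer:
`(x, i)`, `(x + e_i, j)`; top layer: `(x, j)`, `(x + e_j, i)`). -/
theorem halfPlaq_congr_of_isCutPlaq {p : Plaq A d} (hp : IsCutPlaq i j P v p) {U V : Config A d G}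
    (hUV : ∀ l, IsHalfLink e P v l → U l = V l) : halfPlaq e i j v p U = halfPlaq e i j v p V := by
  have hP := hF.two_le
  unfold halfPlaq
  by_cases h0 : v p.1 = 0
  · have hc : (v p.1).val = 0 := (eq_zero_iff_val _).1 h0
    have hi : (v (p.1 + e i)).val = 1 := by rw [hF.val_height_add_left_of p.1 (by omega), hc]
    rw [if_pos h0, if_pos h0, hUV _ (hF.isHalfLink_left (by omega)),
      hUV _ (hF.isHalfLink_right (by omega) (by omega))]
  · have hc : (v p.1).val = P := by
      rcases (hF.layer_iff_val p.1).1 hp.1 with h | h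
      · exact absurd ((eq_zero_iff_val _).2 h) h0
      · exact h
    have hj : (v (p.1 + e j)).val = P - 1 := by rw [hF.val_height_add_right_of p.1 (by omega), hc]
    rw [if_neg h0, if_neg h0, hUV _ (hF.isHalfLink_right (by omega) (by omega)),
      hUV _ (hF.isHalfLink_left (by omega))]

variable {N : ℕ} [TopologicalSpace G] [IsTopologicalGroup G] [CompactSpace G]
variable (ρ : G →* Matrix (Fin N) (Fin N) ℂ)

/-- **The cut-plaquette identity** (Osterwalder–Seiler 1978 §2): for a cut plaquette `p`,
`Re tr ρ(U_p) = ∑_{a,b} Re (σ(A_p(U))_{ab} conj σ(A_p(ΘU))_{ab})`, `A_p` the inner half, `σ` the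
unitarised representation — a Gram kernel between the inner half and its mirror image. -/
theorem plaqObs_eq_sum_halfPlaq (hρ : Continuous ρ) {p : Plaq A d} (hp : IsCutPlaq i j P v p)
    (U : Config A d G) :
    plaqObs ρ e p U = ∑ a, ∑ b,
      (CompactGroup.unitarize ρ hρ (halfPlaq e i j v p U) a b * (starRingEnd ℂ)
        (CompactGroup.unitarize ρ hρ (halfPlaq e i j v p (configSwap i j θ U)) a b)).re := by
  have hcomm : ∀ z w : ℂ, (z * (starRingEnd ℂ) w).re = (w * (starRingEnd ℂ) z).re := fun z w => by
    simp only [Complex.mul_re, Complex.conj_re, Complex.conj_im]; ring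
  rw [hF.halfPlaq_configSwap hp]
  obtain ⟨x, ⟨⟨k, l⟩, hkl⟩⟩ := p
  obtain ⟨-, hI, hJ⟩ := hp
  have hij := hF.ne
  simp only [HasDir] at hI hJ
  unfold plaqObs halfPlaq
  simp only
  rcases hI with rfl | rfl <;> rcases hJ with h | h
  · exact absurd h hij
  · subst h
    rw [show holonomy e U x k l = (U (x, k) * U (x + e k, l)) * (U (x, l) * U (x + e l, k))⁻¹ by
      simp only [holonomy, mul_inv_rev, mul_assoc]]
    by_cases h0 : v x = 0
    · simp only [if_pos h0, CompactGroup.re_trace_mul_inv_eq_sum ρ hρ]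
    · simp only [if_neg h0, CompactGroup.re_trace_mul_inv_eq_sum ρ hρ]
      simp_rw [hcomm (CompactGroup.unitarize ρ hρ (U (x, k) * U (x + e k, l)) _ _)]
  · subst h
    rw [show holonomy e U x k l = (U (x, k) * U (x + e k, l)) * (U (x, l) * U (x + e l, k))⁻¹ by
      simp only [holonomy, mul_inv_rev, mul_assoc]]
    by_cases h0 : v x = 0
    · simp only [if_pos h0, CompactGroup.re_trace_mul_inv_eq_sum ρ hρ]
      simp_rw [hcomm (CompactGroup.unitarize ρ hρ (U (x, k) * U (x + e k, l)) _ _)]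
    · simp only [if_neg h0, CompactGroup.re_trace_mul_inv_eq_sum ρ hρ]
  · exact absurd h hij

/-! ## The Gram coefficients of the cut plaquettes -/

open scoped Classical in
omit hF in
/-- The coefficient functions `a_ι` of the Gram expansion of the cut plaquettes: for
`ι = (p, a, b, s)` with `p` a cut plaquette, `√(β/2) σ(A_p(U))_{ab}` (`s = true`) or its conjugate
(`s = false`); zero if `p` is not cut. -/
def coeff (e : Fin d → A) (i j : Fin d) (v : A →+ ZMod (2 * P)) (hρ : Continuous ρ) (β : ℝ)
    (ι : Plaq A d × Fin N × Fin N × Bool) (U : Config A d G) : ℂ :=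
  if IsCutPlaq i j P v ι.1 then
    (Real.sqrt (β / 2) : ℂ) *
      (if ι.2.2.2 then CompactGroup.unitarize ρ hρ (halfPlaq e i j v ι.1 U) ι.2.1 ι.2.2.1
        else (starRingEnd ℂ) (CompactGroup.unitarize ρ hρ (halfPlaq e i j v ι.1 U) ι.2.1 ι.2.2.1))
  else 0

open scoped Classical in
/-- **The cut part of the Boltzmann weight is a Gram kernel** (`β ≥ 0`):
`∑_ι a_ι(U) conj a_ι(ΘU) = β ∑_{Cut} Re tr ρ(U_p)`. -/
theorem sum_coeff_mul_conj [Fintype A] (hρ : Continuous ρ) {β : ℝ} (hβ : 0 ≤ β)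
    (U : Config A d G) :
    ∑ ι, coeff ρ e i j v hρ β ι U * (starRingEnd ℂ) (coeff ρ e i j v hρ β ι (configSwap i j θ U)) =
      ((β * ∑ p ∈ Finset.univ.filter (IsCutPlaq i j P v), plaqObs ρ e p U : ℝ) : ℂ) := by
  have hs : (Real.sqrt (β / 2) : ℂ) * (Real.sqrt (β / 2) : ℂ) = ((β / 2 : ℝ) : ℂ) := by
    rw [← Complex.ofReal_mul, Real.mul_self_sqrt (by linarith)]
  rw [Finset.mul_sum, Complex.ofReal_sum, Finset.sum_filter, Fintype.sum_prod_type]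
  refine Finset.sum_congr rfl fun p _ => ?_
  by_cases hp : IsCutPlaq i j P v p
  · rw [if_pos hp, hF.plaqObs_eq_sum_halfPlaq ρ hρ hp, Finset.mul_sum, Complex.ofReal_sum,
      Fintype.sum_prod_type]
    refine Finset.sum_congr rfl fun a _ => ?_
    rw [Finset.mul_sum, Complex.ofReal_sum, Fintype.sum_prod_type]
    refine Finset.sum_congr rfl fun b _ => ?_
    rw [Fintype.sum_bool]
    simp only [coeff, if_pos hp, ↓reduceIte, Bool.false_eq_true, map_mul, Complex.conj_ofReal,
      Complex.conj_conj]
    set u := CompactGroup.unitarize ρ hρ (halfPlaq e i j v p U) a b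
    set w := CompactGroup.unitarize ρ hρ (halfPlaq e i j v p (configSwap i j θ U)) a b
    calc (Real.sqrt (β / 2) : ℂ) * u * ((Real.sqrt (β / 2) : ℂ) * (starRingEnd ℂ) w) +
          (Real.sqrt (β / 2) : ℂ) * (starRingEnd ℂ) u * ((Real.sqrt (β / 2) : ℂ) * w)
        = ((Real.sqrt (β / 2) : ℂ) * (Real.sqrt (β / 2) : ℂ)) *
            (u * (starRingEnd ℂ) w + (starRingEnd ℂ) (u * (starRingEnd ℂ) w)) := by
          simp only [map_mul, Complex.conj_conj]; ring
      _ = ((β * (u * (starRingEnd ℂ) w).re : ℝ) : ℂ) := by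
          rw [hs, Complex.add_conj]; push_cast; ring
  · rw [if_neg hp]
    simp [coeff, hp]

omit hF in
open scoped Classical in
/-- The coefficient functions are bounded by `√(β/2)`. -/
theorem norm_coeff_le (hρ : Continuous ρ) (β : ℝ) (ι : Plaq A d × Fin N × Fin N × Bool)
    (U : Config A d G) : ‖coeff ρ e i j v hρ β ι U‖ ≤ Real.sqrt (β / 2) := by
  unfold coeff
  split_ifs with hp hs
  · rw [norm_mul, Complex.norm_real, Real.norm_eq_abs, abs_of_nonneg (Real.sqrt_nonneg _)]
    exact mul_le_of_le_one_right (Real.sqrt_nonneg _)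
      (CompactGroup.norm_unitarize_apply_le_one ρ hρ _ _ _)
  · rw [norm_mul, Complex.norm_real, Real.norm_eq_abs, abs_of_nonneg (Real.sqrt_nonneg _),
      Complex.norm_conj]
    exact mul_le_of_le_one_right (Real.sqrt_nonneg _)
      (CompactGroup.norm_unitarize_apply_le_one ρ hρ _ _ _)
  · rw [norm_zero]
    exact Real.sqrt_nonneg _

open scoped Classical in
/-- The coefficient functions depend only on the links of the closed half. -/
theorem coeff_congr (hρ : Continuous ρ) (β : ℝ) (ι : Plaq A d × Fin N × Fin N × Bool)
    {U V : Config A d G} (hUV : ∀ l, IsHalfLink e P v l → U l = V l) :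
    coeff ρ e i j v hρ β ι U = coeff ρ e i j v hρ β ι V := by
  unfold coeff
  by_cases hp : IsCutPlaq i j P v ι.1
  · simp only [if_pos hp, hF.halfPlaq_congr_of_isCutPlaq hp hUV]
  · simp only [if_neg hp]

variable [MeasurableSpace G] [BorelSpace G] [SecondCountableTopology G]

omit [CompactSpace G] hF in
/-- The inner half is a measurable function of the configuration. -/
theorem measurable_halfPlaq (p : Plaq A d) :
    Measurable fun U : Config A d G => halfPlaq e i j v p U := by
  unfold halfPlaq
  by_cases h0 : v p.1 = 0
  · simp only [if_pos h0]
    exact (measurable_pi_apply _).mul (measurable_pi_apply _)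
  · simp only [if_neg h0]
    exact (measurable_pi_apply _).mul (measurable_pi_apply _)

omit hF in
open scoped Classical in
/-- The coefficient functions are measurable. -/
theorem measurable_coeff (hρ : Continuous ρ) (β : ℝ) (ι : Plaq A d × Fin N × Fin N × Bool) :
    Measurable (coeff ρ e i j v hρ β ι : Config A d G → ℂ) := by
  have hm : ∀ a b, Measurable fun U : Config A d G =>
      CompactGroup.unitarize ρ hρ (halfPlaq e i j v ι.1 U) a b := fun a b =>
    (CompactGroup.continuous_entry (CompactGroup.continuous_unitarize ρ hρ) a b).measurable.comp
      (measurable_halfPlaq ι.1)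
  unfold coeff
  by_cases hp : IsCutPlaq i j P v ι.1
  · simp only [if_pos hp]
    by_cases hs : ι.2.2.2 = true
    · simp only [hs, ↓reduceIte]
      exact (hm _ _).const_mul _
    · simp only [hs, Bool.false_eq_true, ↓reduceIte]
      exact (Complex.continuous_conj.measurable.comp (hm _ _)).const_mul _
  · simp only [if_neg hp]
    exact measurable_const

end Cut

end IsTiltedFrame

end TiltedRP

end Summit.QuantumFields.GaugeBoot
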